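import Literature.Probability.Percolation.SlabRSWGluingHighProbGlue
import HarnessLib

/-!
# Newman–Tassion–Wu 2017, §3.2 (proof of Theorem 3.6 from Theorem 3.7, `S ⊊ R`): a crossing of `R`
# that must cross `S` meets `Γ̄` — `{A ⟷^S B} ∩ {C ⟷^R D'} ⊆ {C̄ ⟷^{R̄} 𝒩(Γ̄, ρ)}` under a two-domain
# planar-crossing hypothesis; hence the high-probability `GL0` form for extended geometries

Topic: `Literature/Probability/Percolation`. Companion to `SlabRSWGluingHighProbGlue.lean` /
`SlabRSWGluingHighProbExt.lean`. NTW (p. 10, proof of Thm. 3.6): "when `R = S`, the event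
`{A ⟷^S B, C ⟷^S D}` implies `{C ⟷^S Γ̄}`, so by the Harris–FKG inequality …"; for the extended
geometries of Prop. 3.9 ((3.28): `Γ` crosses `S = [0,n]²` bottom-to-top and the `C`-path crosses
`R = [0,n+κn]×[0,n]` right-to-left; (3.29) likewise) the same holds because the `C`-path must cross `S`.
The tree's `GlueData.mem_evNear_of_cross` is the case `R = S` (both walks in `S`); this file states the
implication under the TWO-DOMAIN planar-crossing hypothesis (the `A`–`B` walk in `S`, the `C`–`D'` walk in
`R`), whose verification for a given geometry is a planar statement (`exists_mem_support_of_crossing`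
applied to the portion of the `C`-walk inside `S`).

* `GlueData.mem_evNear_of_cross₂` — lattice `ω ∈ {A ⟷^S B} ∩ {C ⟷^R D'}` lies in `evNear ρ`;
* `GlueData.real_evNear_ge_of_cross₂` — hence `P[evNear ρ] ≥ P[A ⟷^S B] + P[C ⟷^R D'] - 1` (no FKG needed),
  so `P[A ⟷^S B], P[C ⟷^R D'] ≥ 1 - δ/2 ⟹ P[evNear ρ] ≥ 1 - δ` — the input of `glue_highProb_ext`.

## Sources

* C. M. Newman, V. Tassion, W. Wu, *Critical percolation and the minimal spanning tree in slabs*,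
  Comm. Pure Appl. Math. 70 (2017), arXiv:1512.09107: §3.2, proof of Theorem 3.6 (p. 10), Prop. 3.9
  (3.28)–(3.29) [NewmanTassionWu2017].
-/

noncomputable section

namespace Literature.Probability.Percolation

open MeasureTheory LatticeModels SimpleGraph

namespace NTW17

variable {k : ℕ}

namespace GlueData

variable {Q : GlueData} {ρ : ℕ}

/-- **A `C`–`D'` crossing of `R` that must cross `S` comes within `0` of `Γ̄`** (two-domain
planar-crossing hypothesis: every planar walk in `S` from `A` to `B` meets every planar walk in `R`
from `C` to `D'`): for lattice `ω ∈ {A ⟷^S B} ∩ {C ⟷^R D'}`, `ω ∈ evNear ρ`.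
[cite: NewmanTassionWu2017, §3.2 (proof of Theorem 3.6: "{A ↔ B, C ↔ D} implies {C ↔ Γ̄}")] -/
theorem mem_evNear_of_cross₂ {Dd : Set (ℤ × ℤ)}
    (hcross : ∀ (l₁ l₂ : List (ℤ × ℤ)) (h₁ : l₁ ≠ []) (h₂ : l₂ ≠ []), IsPlanarWalk l₁ → IsPlanarWalk l₂ →
      (∀ z ∈ l₁, z ∈ Q.S) → (∀ z ∈ l₂, z ∈ Q.R) → l₁.head h₁ ∈ Q.A → l₁.getLast h₁ ∈ Q.B →
      l₂.head h₂ ∈ Q.C → l₂.getLast h₂ ∈ Dd → ∃ z ∈ l₁, z ∈ l₂)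
    {ω : BondConfig (slab 3 k)} (hω : ω ⊆ (slabGraph 3 k).edgeSet) (hAB : ω ∈ Q.evAB k)
    (hCD : ω ∈ slabConn k Q.R Q.C Dd) : ω ∈ Q.evNear k ρ := by
  obtain ⟨hγO, -⟩ := Q.γ_spec hAB
  obtain ⟨L, hL⟩ := (mem_slabConn_iff_exists_isOSAP ω _ _ _).1 hCD
  set γ := Q.γ k ω with hγdef
  have hw₁ := isPlanarWalk_map_planar hω hγO.chain
  have hw₂ := isPlanarWalk_map_planar hω hL.chain
  have hne₁ : γ.map (planar k) ≠ [] := by simpa using hγO.ne_nil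
  have hne₂ : L.map (planar k) ≠ [] := by simpa using hL.ne_nil
  have hhead₁ : (γ.map (planar k)).head hne₁ ∈ Q.A := by
    rw [List.head_map]; exact hγO.head_mem hγO.ne_nil
  have hlast₁ : (γ.map (planar k)).getLast hne₁ ∈ Q.B := by
    rw [List.getLast_map]; exact hγO.last_mem hγO.ne_nil
  have hhead₂ : (L.map (planar k)).head hne₂ ∈ Q.C := by
    rw [List.head_map]; exact hL.head_mem hL.ne_nil
  have hlast₂ : (L.map (planar k)).getLast hne₂ ∈ Dd := by
    rw [List.getLast_map]; exact hL.last_mem hL.ne_nil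
  obtain ⟨z, hz₁, hz₂⟩ := hcross _ _ hne₁ hne₂ hw₁ hw₂
    (fun z hz => by obtain ⟨g, hg, rfl⟩ := List.mem_map.1 hz; exact hγO.subset g hg)
    (fun z hz => by obtain ⟨x, hx, rfl⟩ := List.mem_map.1 hz; exact hL.subset x hx)
    hhead₁ hlast₁ hhead₂ hlast₂
  obtain ⟨g, hg, hgz⟩ := List.mem_map.1 hz₁
  obtain ⟨x, hx, hxz⟩ := List.mem_map.1 hz₂
  refine ⟨L.head hL.ne_nil, hL.head_mem hL.ne_nil, x, hL.openConnIn_of_mem hx, g, hg, ?_⟩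
  rw [hxz, ← hgz]
  exact sqBox_mono _ (Nat.zero_le ρ) (mem_sqBox_self _ _)

/-- **Hence `P[evNear ρ] ≥ P[A ⟷^S B] + P[C ⟷^R D'] - 1`** under the two-domain planar-crossing
hypothesis (union bound; the form that turns `P[A ⟷^S B] ≥ 1 - δ/2` and `P[C ⟷^R D'] ≥ 1 - δ/2` into the
input `P[evNear ρ] ≥ 1 - δ` of `glue_highProb_ext`). [cite: NewmanTassionWu2017, §3.2 (proof of Theorem 3.6)] -/
theorem real_evNear_ge_of_cross₂ {Dd : Set (ℤ × ℤ)}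
    (hcross : ∀ (l₁ l₂ : List (ℤ × ℤ)) (h₁ : l₁ ≠ []) (h₂ : l₂ ≠ []), IsPlanarWalk l₁ → IsPlanarWalk l₂ →
      (∀ z ∈ l₁, z ∈ Q.S) → (∀ z ∈ l₂, z ∈ Q.R) → l₁.head h₁ ∈ Q.A → l₁.getLast h₁ ∈ Q.B →
      l₂.head h₂ ∈ Q.C → l₂.getLast h₂ ∈ Dd → ∃ z ∈ l₁, z ∈ l₂)
    (p : unitInterval) :
    (bondPercolation (slabGraph 3 k) p).real (Q.evAB k) +
        (bondPercolation (slabGraph 3 k) p).real (slabConn k Q.R Q.C Dd) - 1 ≤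
      (bondPercolation (slabGraph 3 k) p).real (Q.evNear k ρ) := by
  set P := bondPercolation (slabGraph 3 k) p with hP
  -- almost surely, the intersection lies in `evNear`
  have hae : ∀ᵐ ω ∂P, ω ∈ Q.evAB k ∩ slabConn k Q.R Q.C Dd → ω ∈ Q.evNear k ρ := by
    filter_upwards [ae_subset_edgeSet (slabGraph 3 k) p] with ω hω
    rintro ⟨hAB, hCD⟩
    exact mem_evNear_of_cross₂ hcross hω hAB hCD
  have hmono : P.real (Q.evAB k ∩ slabConn k Q.R Q.C Dd) ≤ P.real (Q.evNear k ρ) := by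
    simp only [measureReal_def]
    exact ENNReal.toReal_mono (measure_ne_top _ _) (measure_mono_ae hae)
  -- union bound: `P(E ∩ F) ≥ P(E) + P(F) - 1`
  have hunion : P.real (Q.evAB k ∪ slabConn k Q.R Q.C Dd) ≤ 1 := measureReal_le_one
  have hsum : P.real (Q.evAB k) + P.real (slabConn k Q.R Q.C Dd) ≤
      P.real (Q.evAB k ∪ slabConn k Q.R Q.C Dd) + P.real (Q.evAB k ∩ slabConn k Q.R Q.C Dd) := by
    have hfin : (slabLift k Q.R).sym2.Finite := finite_sym2 (slabLift_finite k Q.hRfin)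
    have hm : MeasurableSet (slabConn k Q.R Q.C Dd) := by
      refine measurableSet_of_isLocalEvent_holds ⟨hfin.toFinset, ?_⟩
      rw [Set.Finite.coe_toFinset]
      exact determinedBy_slabConn k _ _ subset_rfl
    rw [measureReal_union_add_inter hm]
  linarith

end GlueData

end NTW17

end Literature.Probability.Percolation

end
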